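import Mathlib
import HarnessLib
import HarnessLib.Audit
import Summits.CriticalPhenomena.Statement
import HarnessLib.Audit.Status.Attr

/-!
Route: FourToThreeSlab

DORMANT since 2026-08-22T16:34:25Z (reconciler: no traction for 5.5 d (last activity item-evidence-added at 2026-08-17T04:17:13Z); parked, not closed — `ledger route dormant route-CriticalPhenomena-FourToThreeSlab --off` to reactivate) — unstaffed, not closed; items shared with open routes are served there. `ledger route dormant <id> --off` reactivates.

# Route FourToThreeSlab — triviality as a resource — the critical slab Z^3 x Z_M is weakly coupled
lattice phi^4_3 made of Ising spins; Z^3 is M = 1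

It suffices to show X = S1 ∧ S2 ∧ S3 for the reflection-positive nearest-neighbour Ising family on
the slabs ℤ³ × ℤ_M (periodic
ring of M sites in a fourth direction; M = 1 is literally the target model ℤ³), each at its own
critical point β_c(M), read on the
layer ℤ³ × {0} (card four-to-three-slab-window, "triviality as a resource"):
S1 (SlabGaussianWindow, the WINDOW): as M → ∞ the zero-Matsubara-mode block field T_(f,M) =
Σ_((x,k)) f(x/M) σ_(x,k) of the critical
slab is asymptotically Gaussian (kurtosis → 3 for every test function f) — 4D marginal triviality
transported to the compactification
scale, i.e. the dimensionally reduced 3D field starts WEAKLY coupled (u(M) ≍ 1/log M);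
S2 (SlabInfraredCompletion, the IR PROBLEM): for all sufficiently thick slabs the layer-0 critical
correlators have a non-degenerate,
Möbius-covariant, non-Gaussian pointwise scaling limit (the conjunct, verbatim, for ℤ³ × ℤ_M instead
of ℤ³);
S3 (RingFamilyUniversality, ONE-RING DESCENT; rev 2, replacing SlabUniversality after route review
c9f4b86e): for every M ≥ 1,
if the critical slab with M + 1 layers has such a limit then so does the slab with M layers —
universality one ring size at a
time along the explicit reflection-positive family, a statement whose instances M ≥ 2 have content
independent of the conjunct;
descending from the thick slabs of S2 to M = 1, which LayerOneIsTarget identifies with ℤ³ itself,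
gives the conjunct.
No separate Target decl is filed: expanded, X is ≈ 6 000 characters; the frame is the deciding
theorem `closes`.
Lean: `Summit.CriticalPhenomena.Ising3DConformalLimit.Theses.FourToThreeSlab.SlabGaussianWindow ∧
Summit.CriticalPhenomena.Ising3DConformalLimit.Theses.FourToThreeSlab.SlabInfraredCompletion ∧
Summit.CriticalPhenomena.Ising3DConformalLimit.Theses.FourToThreeSlab.RingFamilyUniversality`

## Assembly
Deciding theorem `closes` (sorry-free, planner's Sketch2.lean, 20 lines of logic; rev 2):
SlabInfraredCompletion says the slab
property P(M) — a non-degenerate, Möbius-covariant, non-Gaussian pointwise scaling limit of the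
layer-0 critical correlators of
ℤ³ × ℤ_M at β_c(M) — holds for all large M; RingFamilyUniversality (P(M+1) → P(M) for every M ≥ 1)
brings it down by induction to
every M, in particular M = 1; LayerOneIsTarget (P(1) ↔ conjunct: the one-layer slab IS ℤ³) turns
P(1) into Ising3DConformalLimit
(the root abbrev of Literature.Probability.LatticeModels.CritIsing3DConformalLimit, named through
the abbrev so that the open target
is the route's conclusion and not a cone dependency). SlabGaussianWindow and
SlabCriticalPointSandwich are hypotheses the proof does
not use: S1 is the certified initial condition from which SlabInfraredCompletion is to be proved and
the route's kill switch (its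
refutation closes the route), so it is ranked and staffed; the logical spine is S2 → S3-descent → M
= 1 → conjunct. The Assembly
item is restated to the rev-2 spine S1 → S2 → RingFamilyUniversality → LayerOneIsTarget → conjunct
(rev 1 had S1 → S2 →
SlabUniversality → conjunct with SlabUniversality = (S2 → conjunct), implied by the conjunct
itself); it is provable now by the same
descent, and the deciding theorem `closes` proves the spine itself rather than waiting for it.

Rationale: WHY THIS LINE. The standard objection to renormalisation-group attacks on ℤ³ is that the n.n. Ising
model "can be thought of as the model with the
strongest possible coupling, thus excluding existing renormalisation group techniques"
(DuminilCopinICM2022 §6.6; barrier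
RigorousRGSmallParameter). The card manufactures the missing small parameter from a THEOREM instead
of putting it in by hand (no Kac
range, no fractional Laplacian, no large N): on ℤ³ × ℤ_M the model is 4D-critical up to scale M,
where Aizenman–Duminil-Copin's
marginal triviality (AizenmanDuminilCopinAnnals2021 Thm 1.2–1.3, Prop 1.4; two-sided 4D control
DuminilCopinPanis2025LowerBounds =
arXiv:2404.05700 Thm 1.4, 1.8) makes the renormalised coupling ≍ 1/log M, and beyond scale M it is
an honest 3D reflection-positive
Ising system whose dimensionless quartic coupling u(L) ≍ (L/M)/log M grows linearly — thermal
dimensional reduction of 4D field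
theory (doi:10.1103/PhysRevD.23.2305 Appelquist–Pisarski; doi:10.1016/0550-3213(91)90405-m and
doi:10.1142/s0217732393001501
O'Connor–Stephens(–Freire): λφ⁴₄ at finite extent flows from the trivial UV to the 3D Wilson–Fisher
point; Cardy1996 §4.4–4.5,
pp. 68–74: "two fixed points on the critical surface", the (d+1)-dimensional one unstable, the
d-dimensional one stable). Imported
areas: constructive QFT / rigorous RG about the Gaussian point (BrydgesFrohlichSokal1983,
GawedzkiKupiainenMasslessLattice1985,
BrydgesMitterScoppola2003, Abdesselam2007) for S2's start, random-current geometry (ADC) for S1,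
finite-size/crossover scaling
(FisherBarber1972, CapehartFisher1976) as the dictionary M = inverse temperature = film thickness.
What no existing route of this
sub does (PerfectScreening, HyperoctahedralRP, AnomalousForcesInteraction, IsingEuclidUpgrade,
IsingCFTData are all "given a limit,
upgrade it" lines): it poses Aizenman's open problem (i) (Aizenman2021CDM §11: boost φ⁴-type
non-triviality "beyond the perturbative
regime to the critical manifold") on a lattice ISING model that keeps reflection positivity,
GKS/GHS/Lebowitz and random currents at
every M and contains the target as a member; the negatives index (one SAW item) is not touched.

RANKED CRUXES. #2 SlabInfraredCompletion (crux) — [card (S2), IR completion] For all sufficiently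
large M (eventually in M), the critical nearest-neighbour Ising model on ℤ³ × ℤ_M (plus state =
limit along boxes box 3 L ×ˢ ℤ_M, h = 0, β = β_c(M) := inf{β ≥ 0 : ⟨σ_(0,0)⟩⁺ > 0}) read on the
layer ℤ³ × {0} has a pointwise scaling limit exactly in the sense of the conjunct: ∃ ρ > 0 on (0,1],
Δ > 0, S with HasPointwiseScalingLimit (layer-0 critical correlators) ρ S, IsNondegenerateTwoPoint
S, IsMoebiusCovariant Δ S, HasNontrivialU4 S. To be attacked from the controlled weak-coupling
initial condition certified by SlabGaussianWindow: follow the 3D flow u(L) ≍ (L/M)/log M from u(M) ≈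
0 through u ≍ 1 (L ≍ M log M) into the infrared — the Ising₃ fixed point approached along the
Gaussian point's unstable manifold, with RP, GKS, GHS, Lebowitz and random currents all available on
the lattice (the conjunction continuum Φ⁴₃ lacks). Existential in (ρ, Δ, S), so no
coincident-configuration junk (cf. Theorems/IsingEuclidUpgradeRefutations). [deps:
SlabGaussianWindow] [difficulty: open-problem] (why it might fail: It is the ε = 1 strong-coupling
IR problem: from u ≍ 1/log M at scale M the flow must be run through u ≍ 1 (scale ≍ M log M) to a
non-Gaussian fixed point no rigorous RG controls (GiulianiMastropietroRychkov2021 §1); rotations and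
the inversion must moreover emerge on the lattice.) [Aizenman2021CDM, DuminilCopinICM2022,
GiulianiMastropietroRychkov2021, BrydgesMitterScoppola2003, Abdesselam2007, KochWittwer1986,
BrydgesFrohlichSokal1983, GawedzkiKupiainenMasslessLattice1985, doi:10.1142/s0217732393001501]
#3 SlabGaussianWindow (crux) — [card (S1), the window theorem] For every continuous compactly
supported f : ℝ³ → ℝ, f ≠ 0, the kurtosis ⟨T⁴⟩/⟨T²⟩² of the zero-Matsubara-mode block field
T_(f,M)(σ) = Σ_((x,k) ∈ ℤ³×ℤ_M) f(x/M) σ_(x,k) in the critical plus state of ℤ³ × ℤ_M (β = β_c(M), h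
= 0) tends to 3 as M → ∞: the dimensionally reduced field at the compactification scale is
asymptotically Gaussian (its Gaussian covariance is then forced to be the 3D Coulomb kernel ∫∫
f(y)f(y')/|y−y'|, the ring-integrated periodised 4D kernel — not filed). This is
Aizenman–Duminil-Copin's d = 4 marginal triviality (|⟨e^(zT)⟩ − e^(z²⟨T²⟩/2)| ≤ C (log L)^(-c))
transported to the slab at scale M and its own β_c(M); by Newman's Lee–Yang-class inequalities U₄ →
0 is full Gaussianity. Normalisation-free (a ratio), infinite volume in the ℤ³ directions (so no
zero-mode φ⁴ anomaly of periodic boxes). [difficulty: XL] (why it might fail: ADC's (log L)^(-c)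
gain (regular scales, sliding-scale IRB, intersection mixing) must be redone on ℤ³×ℤ_M at β_c(M) >
β_c(ℤ⁴), currents winding round the ring; T_(f,M) also feels scales ≳ M where geometry is 3D and
currents DO meet — if that part of U₄ is O(1), not O(1/log M), kurtosis stays < 3.)
[AizenmanDuminilCopinAnnals2021, DuminilCopinPanis2025LowerBounds, arXiv:2404.05700,
Newman1975Gaussian, doi:10.1103/PhysRevD.23.2305, Cardy1996, FisherBarber1972, CapehartFisher1976]
#4 RingFamilyUniversality (crux) — [card (S3), one-ring descent; rev 2 — replaces SlabUniversality
after route review c9f4b86e] For every M ≥ 1: if the critical nearest-neighbour Ising model on ℤ³ ×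
ℤ_(M+1) (plus state = limit along boxes box 3 L ×ˢ ℤ_(M+1), h = 0, at its own β_c(M+1) := inf{β ≥ 0
: ⟨σ_(0,0)⟩⁺ > 0}) read on the layer ℤ³ × {0} has a pointwise scaling limit in the sense of the
conjunct (∃ ρ > 0 on (0,1], Δ > 0, S with HasPointwiseScalingLimit, IsNondegenerateTwoPoint,
IsMoebiusCovariant Δ, HasNontrivialU4 — the slab property P(M+1), verbatim as inside
SlabInfraredCompletion), then so does ℤ³ × ℤ_M at β_c(M) (P(M)). Universality ONE RING SIZE AT A
TIME along the explicit reflection-positive family joining weakly coupled lattice φ⁴₃ (M large) to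
Ising₃ (M = 1): after integrating the ring each member is a 3D RP ferromagnet with an Ising-ring
single-site law (a Griffiths–Simon-type block), and in RG language adjacent members lie on the
critical surface in the basin of the same infrared fixed point ("they all have the same long
distance behavior", KochWittwer1986 §1; Cardy1996 §4.5: the finite-extent transition of the
(d+1)-dimensional system is in the d-dimensional class). Unlike the rev-1 S3 ((∀ᶠ M, P M) →
conjunct, which the conjunct itself implies), the instances M ≥ 2 have content independent of the
target; expected in the stronger form "same Δ and the same S up to normalisation"
(ThickSlabLimitsAgree, not required by the deciding theorem). With SlabInfraredCompletion it yields
P(M) for every M by descent, and LayerOneIsTarget turns P(1) into the conjunct. [deps: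
SlabInfraredCompletion] [difficulty: open-problem] (why it might fail: Fails iff for some M the
(M+1)-ring slab reaches the conformal non-Gaussian limit at β_c(M+1) while the M-ring slab at β_c(M)
does not (adjacent ring sizes in different IR classes, or only scale-covariant); no comparison at
different β exists — GKS is equal-β; uniform-in-M control = slab barrier.) [DuminilCopinICM2022,
KochWittwer1986, GriffithsSimon1973, Cardy1996, doi:10.1103/physrevlett.72.506,
Literature.Barriers.CriticalPhenomena.SlabLimitUniformControl,
Literature.Barriers.CriticalPhenomena.RigorousRGSmallParameter]
#9 LayerOneIsTarget (support) — [support, encoding check, provable now] The M = 1 member of the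
family IS the target: the slab statement at M = 1 (graph zdGraph 3 □ torusGraph 1 1 = ℤ³ × one
point, no ring edges; boxes box 3 L ×ˢ univ; plus boundary condition; β_c(1); layer-0 spin
monomials) is equivalent to the conjunct Ising3DConformalLimit (the sub-problem Statement decl by
name; = Literature.Probability.LatticeModels.CritIsing3DConformalLimit by rfl — restated 2026-08-15
to name the @[summit_statement] abbrev so the Literature conjecture is target-side, not a cone
dependency). Proof: transport isingExpect along the graph isomorphism (x, ∗) ↦ x (IsingTransport /
IsingAutomorphismCovariance), so the slab plus state, magnetisation, β_c(1) and critical correlators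
are literally plusExpect 3, spontaneousMagnetization 3, criticalBeta 3, criticalCorr 3. Guards the
inlined encoding used by all cruxes and, from rev 2, is LOAD-BEARING: the deciding theorem ends with
it (P(1) → conjunct). [difficulty: provable-now] [FriedliVelenik2017,
Literature.Probability.LatticeModels.criticalCorr, Ising3DConformalLimit]
#9 SlabCriticalPointSandwich (support) — [support, well-posedness of the family] For every M ≥ 1 the
slab critical point is a genuine finite positive number below the 3D one: 0 < β_c(M) ≤ β_c(ℤ³) =
criticalBeta 3. Upper bound: GKS — adding the inter-layer bonds to M decoupled copies of ℤ³ raises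
⟨σ_(0,0)⟩⁺ in every box, so m*_M(β) ≥ m*_ℤ³(β) and the infimum drops (needs the ℤ³ set non-empty:
β_c(3) < ∞, Peierls). Lower bound: the slab graph has degree ≤ 8, so for 8 tanh β < 1 (high
temperature, uniformly in M) the plus state has zero magnetisation (Fisher/Griffiths
high-temperature bound or Dobrushin uniqueness). Expected also (not filed): β_c(M) ↓ β_c(ℤ⁴) ≈
0.1497 with shift ≍ M^(-2) up to logarithms (FisherBarber1972, CapehartFisher1976). [difficulty:
provable-now] [FriedliVelenik2017, GriffithsSimon1973, FisherBarber1972]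

TWO-LAYER PLAN. Foreseen glued splits (none filed now; k ≤ 3, depth 1): SlabGaussianWindow ⇐
SlabRegularScales (ADC §5 on ℤ³×ℤ_M up to scale M at
β_c(M): sliding-scale infrared bound + abundance of regular scales, using RP of the slab in the ℤ³
directions) → SlabImprovedTreeBound
(Thm 1.3 analogue: |U₄| ≤ C B_M^(-c) · tree for points at mutual distance ≍ M, B_M(β_c(M)) ≥ (log
M)^c) → ZeroModeTail (the scales ≳ M
contribute O(u(M)) to U₄(T_(f,M))) → SlabGaussianWindow. SlabInfraredCompletion ⇐
ThickSlabScaleCovariantLimit (existence + scale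
covariance + U₄ ≢ 0 by RG from the window, the genuinely constructive child) →
ThickSlabMoebiusUpgrade (rotations + inversion; may be
imported from HyperoctahedralRP / IsingEuclidUpgrade-type items restated for the slab) →
SlabInfraredCompletion. RingFamilyUniversality (the filed
crux since rev 2; the rev-1 parent SlabUniversality = (S2 → conjunct) was implied by the conjunct
and is retired) ⇐ its expected
strengthening ThickSlabLimitsAgree (eventual M-independence of the thick-slab limits up to
normalisation, same Δ — a weak-coupling
statement: all start on the Gaussian point's unstable manifold); no split filed.

KILL CRITERIA. SlabGaussianWindow refuted (the zero mode at scale M is NOT asymptotically Gaussian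
at β_c(M): no small parameter is manufactured) ⇒
close `refuted:SlabGaussianWindow` — the mechanism is dead, not just the decomposition.
SlabInfraredCompletion refuted for thick slabs
(e.g. thick critical slabs proved Gaussian in the IR, or proved to have no Möbius-covariant limit) ⇒
close refuted and hand the
witness to the negatives index: by the universality logic of S3 it is strong evidence against the
conjunct itself.
RingFamilyUniversality refuted (some M: the (M+1)-ring slab has the limit, the M-ring slab does not
— adjacent ring sizes in different
infrared classes) ⇒ close refuted: universality along the family, the route's transfer mechanism, is
dead (at M = 1 the witness is
moreover a disproof of the target, closing every route of the sub).
A proof of the conjunct by any other route moots this one; proofs of the covariance upgrades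
elsewhere (HyperoctahedralRP,
IsingEuclidUpgrade) shrink SlabInfraredCompletion to existence + scale covariance + U₄ ≢ 0 (pivot by
--split, not a new route).

NOT DECOMPOSED YET. Deliberately not filed at open: the RATE in the window (3 − kurtosis ≍ 1/log M
two-sidedly; only the upper bound is ADC-shaped, the
lower bound is a d < 4 input); the two-point crossover shape at scale M (A_M⁻¹ Σ_(k∈ℤ) (|y|² +
k²)⁻¹, finer than anything known even on
ℤ⁴, where G ≍ |x|⁻² is known only up to a log, arXiv:2404.05700 Thm 1.4); β_c(M) − β_c(ℤ⁴) ≍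
M⁻²/log-power (Fisher–Barber shift);
reflection positivity of ℤ³ × ℤ_M in the nine ℤ³ mirror families and in the ring direction, and the
GS-type structure of the
ring-decimated single-site law (routine, become `--supports` lemmas); the Banach-space set-up of the
RG map for S2 (the real work, to be
split only after S1 lands); any Kac / long-range comparison (other cards: lambda-infinity-square,
long-range-crossover-endpoint).

CHEAPEST FALSIFIER. Numerics of S1 (a kit Monte-Carlo job a refuter can run; not run by me —
plancard is one-shot planning): Wolff-cluster simulation of
ℤ³-periodic boxes of side 8M × ring M, M ∈ {1, 2, 4, 8, 16}, at β_c(M) located by Binder crossing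
(β_c(1) = 0.22165, β_c(∞) = 0.14969
bracket it); measure the kurtosis of T_(f,M) for f = bump of radius 1 (support diameter ≈ 2M ≪ box).
Prediction: 3 − K_M decreases
monotonically in M roughly like c/log M from its M = 1 value (the scale-invariant non-Gaussian ℤ³
ratio); a deficit that saturates at
an M-independent positive value kills S1. Cheaper still, analytically: the 4D→3D crossover of
Dyson's hierarchical model (block
recursion with the fourth direction compactified after log₂ M steps) must show the effective quartic
coupling at step log₂ M to be
≍ 1/log M — a one-page computation with the Koch–Wittwer / Gawędzki–Kupiainen hierarchical formulas.

NUMBERS. β_c(ℤ³) = 0.221654626(5) (doi:10.1103/PhysRevE.97.043301, Ferrenberg–Xu–Landau 2018);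
β_c(ℤ⁴) = 0.1496947(5) (doi:10.1103/PhysRevE.80.031104,
Lundow–Markström 2009), so β_c(M) runs from 0.2217 (M = 1) down to 0.1497 (M → ∞); 4D: η = 0, G(x)
between c/(|x|² log|x|) and C/|x|²
(arXiv:2404.05700 Thm 1.4; infrared bound), bubble B(β_c) = ∞ (Thm 1.8), smeared MGF deviation ≤ C
(log L)^(-c) (AizenmanDuminilCopinAnnals2021
Prop 1.4); dimensional reduction: λ₃ = λ₄(M)/M, u(L) = λ₃ L ≍ (L/M)/log M, crossover scale L* ≍ M
log M; 3D targets Δ_σ = 0.5181489(10),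
η = 0.036298(2) (BehanEtAl2017 §3; ElShowkEtAl2012); film shift exponent λ = 1/ν₄ = 2
(FisherBarber1972). Items at open: 6 (3 cruxes,
2 support, 1 assembly); rev 2: 6 (3 cruxes, 2 support, 1 assembly restated to the new spine;
deciding theorem `closes`).

DEFINITION REQUESTS. The slab notions are INLINED in every decl (so all items elaborate today, rc
0): slab graph `zdGraph 3 □ torusGraph 1 M` on
`Site 3 × TorusSite 1 M`, volumes `box 3 L ×ˢ Finset.univ`, plus state `limUnder atTop (isingExpect
… β 0 .plus ·)`, β_c(M) as the sInf
over {β ≥ 0 : ⟨σ_(0,0)⟩⁺ > 0}, layer-0 critical correlators via `spinMonomial fun i => (x i, 0)`.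
Wanted as Literature definitions (filed
with `ledger workitem add --kind definition` after open, topic
Literature/Probability/LatticeModels): `slabPlusExpect M β f`,
`slabCriticalBeta M`, `slabCriticalCorr M : LatticeCorrFamily 3`, `slabZeroModeField M f` — the
Ising model on ℤ^d × ℤ_M generally —
so that later restatements read in one line; no cite facts are requested (ADC's d = 4 theorems exist
as named facts for ℤ⁴,
`Literature.Probability.LatticeModels.aizenmanDuminilCopin_improvedTreeDiagramBound`, and are NOT
imported by any item here: the
slab versions are the content of SlabGaussianWindow).

Novelty: Searches (2026-08-15): `ledger idea list --sub Ising3DConformalLimit` (≈ 110 cards; related: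
film-ladder-dimensional-crossover,
long-range-crossover-endpoint, lambda-infinity-square, phi43-coupling-homogenisation,
strong-coupling-is-infrared (retired) — none uses
the 4D theorem on a thick slab); the five route files of the sub (no RG / slab line); `lit search
--hybrid "dimensional crossover Ising
film thickness critical temperature shift four dimensions three"` (10 held books:
FriedliVelenik2017, Cardy1996 pp. 66–74, Binder MC
volumes — physics background only); `lit search --source crossref "O'Connor Stephens environmentally
friendly renormalization dimensional
crossover"` (8: doi:10.1103/physrevlett.72.506, doi:10.1088/0305-4470/25/1/014,
doi:10.1098/rspa.1994.0018, …); `lit search --source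
crossref "critical Ising model slab periodic dimensional crossover scaling limit Gaussian"` (8, none
relevant: 2D scaling limits,
random-field crossover); `lit search --source crossref "layered Ising model critical temperature
film thickness bounds Griffiths
inequalities"` (8: Weng–Griffiths–Fisher 1967 doi:10.1103/physrev.162.475 bounds on anisotropic T_c,
Hong 1990 films — T_c(M) numerics
only); `lit read arxiv:2404.05700` (Thm 1.2–1.8 read, pp. 5–6); `lit galaxy search "dimensional
crossover" --star all` and `"dimensional
reduction finite temperature phi4 …" --star all` (service saturated twice, substring pass returned
only noise — logged, nothing
citable); openalex / arxiv / s2 back-  [refs: 10.1103/physrevlett.72.506, 10.1088/0305-4470/25/1/014, 10.1098/rspa.1994.0018, 10.1103/physrev.162.475, 10.1142/s0217732393001501, 10.1016/0550-3213(91, 10.1103/PhysRevD.23.2305, 2404.05700, doi:10.1103/physrevlett.72.506, doi:10.1088/0305-4470/25/1/014, doi:10.1098/rspa.1994.0018, doi:10.1103/physrev.162.475, arxiv:2404.05700, doi:10.1142/s0217732393001501, doi:10.1016/0550-3213, doi:10.1103/Phy]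

Barriers (technique_class: dimensional-crossover-slab, weak-coupling, rigorous-rg): - technique_class: dimensional-crossover-slab, weak-coupling, rigorous-rg
- Literature.Barriers.CriticalPhenomena.RigorousRGSmallParameter: turned around, then honestly
re-entered — the barrier records that rigorous RG needs a small parameter the n.n. ℤ³ model lacks
(ε-regime, `not_epsilonRegime_nearestNeighbour`); S1 exhibits a genuine n.n. Ising model (ℤ³×ℤ_M)
whose 3D effective coupling IS small (≍ 1/log M) at scales ≥ M, so weak-coupling RG is legitimate in
the window M ≤ L ≪ M log M; the barrier bites again in S2 (the flow leaves the window; ε = 1, scope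
caveat (a): no theorem forbids it, none achieves it) and in S3 (M = 1 has no window) — both filed as
cruxes with that stated; scope caveat (g) of the barrier ("universality in the bare coupling … would
put weakly coupled lattice φ⁴ in the same infrared class") is exactly S3.
- Literature.Barriers.CriticalPhenomena.RigorousRGSmallParameterNarrow: it does not evade the
narrowed barrier, and says so: the audit's point — the obstruction is the missing small parameter AT
THE FIXED POINT (ε = 1 on the full lattice), not the bare strong coupling of the ±1 law — is exactly
the split S1 / S2 of this route. S1 supplies on the FULL lattice (ℤ³×ℤ_M, via ADC's currents) what
Hara–Hattori–Watanabe supply hierarchically in d = 4: an honest Ising start provably inside the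
weak-coupling regime (at scale M); S2 then faces ε = 1 with no small parameter and is filed as the
open problem it is (Difficulty open-problem). The bet is that a CONT

History (route lifecycle, newest last):
- 2026-08-15T16:53:42Z · rev 2: restated SlabUniversality (stmt-CriticalPhenomena-4815), LayerOneIsTarget (stmt-CriticalPhenomena-4816), Assembly (stmt-CriticalPhenomena-4818) — route-repair (cone, g2) + route-review follow-up, ONE edit (rev 2): (1) CONE — the route's single unproved cone dependency was the OPEN TARGET ITSELF, Literatur (planner-rrepair-CriticalPhenomena-FourToThreeS-647d721a-g2-0)
- 2026-08-22T16:34:25Z · DORMANT — reconciler: no traction for 5.5 d (last activity item-evidence-added at 2026-08-17T04:17:13Z); parked, not closed — `ledger route dormant route-CriticalPhenomen (operator:999:2498325)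

sub-problem: Ising3DConformalLimit · status: dormant · opened planner-plancard-CriticalPhenomena-Ising3DCon-9918d4cd-0 2026-08-15T11:35:09Z · rev 3 · ledger route-CriticalPhenomena-FourToThreeSlab
GENERATED by the gate from the ledger (D-0016/17). Provers cite these decls: `theorem foo : Summit.CriticalPhenomena.Ising3DConformalLimit.Theses.FourToThreeSlab.<Decl> := …` in Summits/CriticalPhenomena/Ising3DConformalLimit/Theorems/<Name>.lean.
-/

namespace Summit.CriticalPhenomena.Ising3DConformalLimit.Theses.FourToThreeSlab

open scoped BigOperators Topology Manifold Classical MeasureTheory ProbabilityTheory Matrix InnerProductSpace ComplexConjugate ContinuousMap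
open Filter Set Function TopologicalSpace MeasureTheory

attribute [summit_statement] _root_.Ising3DConformalLimit

/-- item stmt-CriticalPhenomena-4813 · crux · rank 2 · open · by planner
why it might fail: Open even for this cousin model: the limit may exist only subsequentially, or be scale+Euclidean but not inversion covariant (ScaleCovarianceNotMoebius); m*(β_c(M))>0 would force Δ=0 (slab continuity not in print, ADS2015 is ℤ^d); ε=1: no rigorous RG runs u≍1/log M through u≍1 to the IR fixed point.
sources: DuminilCopinICM2022, Aizenman2021CDM, GiulianiMastropietroRychkov2021, AizenmanDuminilCopinSidoravicius2015, Literature.Barriers.CriticalPhenomena.ScaleCovarianceNotMoebius, Literature.Barriers.CriticalPhenomena.RigorousRGSmallParameterNarrow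
[crux] [card (S2), IR completion] For all sufficiently large M (eventually in M), the critical
nearest-neighbour Ising model on ℤ³ × ℤ_M (plus state = limit along boxes box 3 L ×ˢ ℤ_M, h = 0, β =
β_c(M) := inf{β ≥ 0 : ⟨σ_(0,0)⟩⁺ > 0}) read on the layer ℤ³ × {0} has a pointwise scaling limit
exactly in the sense of the conjunct: ∃ ρ > 0 on (0,1], Δ > 0, S with HasPointwiseScalingLimit
(layer-0 critical correlators) ρ S, IsNondegenerateTwoPoint S, IsMoebiusCovariant Δ S,
HasNontrivialU4 S. To be attacked from the controlled weak-coupling initial condition certified by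
SlabGaussianWindow: follow the 3D flow u(L) ≍ (L/M)/log M from u(M) ≈ 0 through u ≍ 1 (L ≍ M log M)
into the infrared — the Ising₃ fixed point approached along the Gaussian point's unstable manifold,
with RP, GKS, GHS, Lebowitz and random currents all available on the lattice (the conjunction
continuum Φ⁴₃ lacks). Existential in (ρ, Δ, S), so no coincident-configuration junk (cf.
Theorems/IsingEuclidUpgradeRefutations). [deps: SlabGaussianWindow] [difficulty: open-problem] -/
@[route_item "route-CriticalPhenomena-FourToThreeSlab", crux]
def SlabInfraredCompletion : Prop :=
  (∀ᶠ M : ℕ in Filter.atTop, ∀ [NeZero M], ∃ (ρ : ℝ → ℝ) (Δ : ℝ) (S : Literature.Probability.LatticeModels.CorrFamily 3), (∀ δ ∈ Set.Ioc (0:ℝ) 1, 0 < ρ δ) ∧ 0 < Δ ∧ Literature.Probability.LatticeModels.HasPointwiseScalingLimit (fun (n : ℕ) (x : Fin n → Literature.Probability.LatticeModels.Site 3) => limUnder Filter.atTop (fun L : ℕ => Literature.Probability.LatticeModels.isingExpect (Literature.Probability.LatticeModels.zdGraph 3 □ Literature.Probability.LatticeModels.torusGraph 1 M) (Literature.Probability.LatticeModels.box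 3 L ×ˢ Finset.univ) (sInf {β : ℝ | 0 ≤ β ∧ 0 < limUnder Filter.atTop (fun L : ℕ => Literature.Probability.LatticeModels.isingExpect (Literature.Probability.LatticeModels.zdGraph 3 □ Literature.Probability.LatticeModels.torusGraph 1 M) (Literature.Probability.LatticeModels.box 3 L ×ˢ Finset.univ) β 0 Literature.Probability.LatticeModels.BoundaryCondition.plus (Literature.Probability.LatticeModels.spinAt (0, 0)))}) 0 Literature.Probability.LatticeModels.BoundaryCondition.plus (Literature.Probability.LatticeModels.spinMonomial fun i => (x i, 0)))) ρ S ∧ Literature.Probability.LatticeModels.IsNondegenerateTwoPoint S ∧ Literature.Probability.LatticeModels.IsMoebiusCovariant Δ S ∧ Literature.Probability.LatticeModels.HasNontrivialU4 S)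

/-- item stmt-CriticalPhenomena-4814 · crux · rank 3 · open · by planner
why it might fail: ADC's (log L)^(-c) gain (regular scales, sliding-scale IRB, intersection mixing) must be redone on ℤ³×ℤ_M at its own β_c(M)>β_c(ℤ⁴), currents winding round the ring; T_(f,M) sits AT the crossover scale, so the 3D scales ≳M (currents DO meet) must add only O(1/log M) to U₄ — if O(1), kurtosis ↛ 3.
sources: AizenmanDuminilCopinAnnals2021, DuminilCopinPanis2025LowerBounds, arXiv:2404.05700, Newman1975Gaussian, Aizenman1982, Literature.Barriers.CriticalPhenomena.IsingTrivialityFromDimensionFour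
[crux] [card (S1), the window theorem] For every continuous compactly supported f : ℝ³ → ℝ, f ≠ 0,
the kurtosis ⟨T⁴⟩/⟨T²⟩² of the zero-Matsubara-mode block field T_(f,M)(σ) = Σ_((x,k) ∈ ℤ³×ℤ_M)
f(x/M) σ_(x,k) in the critical plus state of ℤ³ × ℤ_M (β = β_c(M), h = 0) tends to 3 as M → ∞: the
dimensionally reduced field at the compactification scale is asymptotically Gaussian (its Gaussian
covariance is then forced to be the 3D Coulomb kernel ∫∫ f(y)f(y')/|y−y'|, the ring-integrated
periodised 4D kernel — not filed). This is Aizenman–Duminil-Copin's d = 4 marginal triviality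
(|⟨e^(zT)⟩ − e^(z²⟨T²⟩/2)| ≤ C (log L)^(-c)) transported to the slab at scale M and its own β_c(M);
by Newman's Lee–Yang-class inequalities U₄ → 0 is full Gaussianity. Normalisation-free (a ratio),
infinite volume in the ℤ³ directions (so no zero-mode φ⁴ anomaly of periodic boxes). [difficulty:
XL] -/
@[route_item "route-CriticalPhenomena-FourToThreeSlab", crux]
def SlabGaussianWindow : Prop :=
  ∀ (f : EuclideanSpace ℝ (Fin 3) → ℝ), Continuous f → HasCompactSupport f → f ≠ 0 → ∀ ε : ℝ, 0 < ε → ∃ M₀ : ℕ, ∀ (M : ℕ) [NeZero M], M₀ ≤ M → |limUnder Filter.atTop (fun L : ℕ => Literature.Probability.LatticeModels.isingExpect (Literature.Probability.LatticeModels.zdGraph 3 □ Literature.Probability.LatticeModels.torusGraph 1 M) (Literature.Probability.LatticeModels.box 3 L ×ˢ Finset.univ) (sInf {β : ℝ | 0 ≤ β ∧ 0 < limUnder Filter.atTop (fun L : ℕ => Literature.Probability.LatticeModels.isingExpect (Literature.Probability.LatticeModels.zdGraph 3 □ Literature.Probability.LatticeModels.torusGraph 1 M) (Literature.Probability.LatticeModels.box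 3 L ×ˢ Finset.univ) β 0 Literature.Probability.LatticeModels.BoundaryCondition.plus (Literature.Probability.LatticeModels.spinAt (0, 0)))}) 0 Literature.Probability.LatticeModels.BoundaryCondition.plus (fun σ => (fun σ : Literature.Probability.LatticeModels.SpinConfig (Literature.Probability.LatticeModels.Site 3 × Literature.Probability.LatticeModels.TorusSite 1 M) => ∑ᶠ p : Literature.Probability.LatticeModels.Site 3 × Literature.Probability.LatticeModels.TorusSite 1 M, f (WithLp.toLp 2 fun i => ((p.1 i : ℤ) : ℝ) / (M : ℝ)) * Literature.Probability.LatticeModels.spinAt p σ) σ ^ 4)) / limUnder Filter.atTop (fun L : ℕ => Literature.Probability.LatticeModels.isingExpect (Literature.Probability.LatticeModels.zdGraph 3 □ Literature.Probability.LatticeModels.torusGraph 1 M) (Literature.Probability.LatticeModels.box 3 L ×ˢ Finset.univ) (sInf {β : ℝ | 0 ≤ β ∧ 0 < limUnder Filter.atTop (fun L : ℕ => Literature.Probability.LatticeModels.isingExpect (Literature.Probability.LatticeModels.zdGraph 3 □ Literature.Probability.LatticeModels.torusGraph 1 M) (Literature.Probability.LatticeModels.box 3 L ×ˢ Finset.univ)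 β 0 Literature.Probability.LatticeModels.BoundaryCondition.plus (Literature.Probability.LatticeModels.spinAt (0, 0)))}) 0 Literature.Probability.LatticeModels.BoundaryCondition.plus (fun σ => (fun σ : Literature.Probability.LatticeModels.SpinConfig (Literature.Probability.LatticeModels.Site 3 × Literature.Probability.LatticeModels.TorusSite 1 M) => ∑ᶠ p : Literature.Probability.LatticeModels.Site 3 × Literature.Probability.LatticeModels.TorusSite 1 M, f (WithLp.toLp 2 fun i => ((p.1 i : ℤ) : ℝ) / (M : ℝ)) * Literature.Probability.LatticeModels.spinAt p σ) σ ^ 2)) ^ 2 - 3| < ε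

/-- item stmt-CriticalPhenomena-11229 · crux · rank 4 · open · by planner
why it might fail: No universality theorem exists in d=3 even between two n.n.-type lattices (2D needs isoradial integrability, Chelkak–Smirnov); members sit at different β_c(M), so GKS/current comparisons (equal β, same graph) give nothing; at M=1 it reads P(2)→conjunct, false iff ℤ³ alone misses the conformal limit.
sources: DuminilCopinICM2022, ChelkakSmirnov2012Ising, KochWittwer1986, GriffithsSimon1973, Cardy1996, OconnorStephens1994
[crux] [card (S3), one-ring descent; rev 2 — replaces SlabUniversality after route review c9f4b86e]
For every M ≥ 1: if the critical nearest-neighbour Ising model on ℤ³ × ℤ_(M+1) (plus state = limit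
along boxes box 3 L ×ˢ ℤ_(M+1), h = 0, at its own β_c(M+1) := inf{β ≥ 0 : ⟨σ_(0,0)⟩⁺ > 0}) read on
the layer ℤ³ × {0} has a pointwise scaling limit in the sense of the conjunct (∃ ρ > 0 on (0,1], Δ >
0, S with HasPointwiseScalingLimit, IsNondegenerateTwoPoint, IsMoebiusCovariant Δ, HasNontrivialU4 —
the slab property P(M+1), verbatim as inside SlabInfraredCompletion), then so does ℤ³ × ℤ_M at
β_c(M) (P(M)). Universality ONE RING SIZE AT A TIME along the explicit reflection-positive family
joining weakly coupled lattice φ⁴₃ (M large) to Ising₃ (M = 1): after integrating the ring each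
member is a 3D RP ferromagnet with an Ising-ring single-site law (a Griffiths–Simon-type block), and
in RG language adjacent members lie on the critical surface in the basin of the same infrared fixed
point ("they all have the same long distance behavior", KochWittwer1986 §1; Cardy1996 §4.5: the
finite-extent transition of the (d+1)-dimensional system is in the d-dimensional class). Unlike the
rev-1 S3 ((∀ᶠ -/
@[route_item "route-CriticalPhenomena-FourToThreeSlab", crux]
def RingFamilyUniversality : Prop :=
  ∀ (M : ℕ) [NeZero M], (∃ (ρ : ℝ → ℝ) (Δ : ℝ) (S : Literature.Probability.LatticeModels.CorrFamily 3), (∀ δ ∈ Set.Ioc (0:ℝ) 1, 0 < ρ δ) ∧ 0 < Δ ∧ Literature.Probability.LatticeModels.HasPointwiseScalingLimit (fun (n : ℕ) (x : Fin n → Literature.Probability.LatticeModels.Site 3) => limUnder Filter.atTop (fun L : ℕ => Literature.Probability.LatticeModels.isingExpect (Literature.Probability.LatticeModels.zdGraph 3 □ Literature.Probability.LatticeModels.torusGraph 1 (M + 1)) (Literature.Probability.LatticeModels.box 3 L ×ˢ Finset.univ) (sInf {β : ℝ | 0 ≤ β ∧ 0 < limUnder Filter.atTop (fun L : ℕ =>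 Literature.Probability.LatticeModels.isingExpect (Literature.Probability.LatticeModels.zdGraph 3 □ Literature.Probability.LatticeModels.torusGraph 1 (M + 1)) (Literature.Probability.LatticeModels.box 3 L ×ˢ Finset.univ) β 0 Literature.Probability.LatticeModels.BoundaryCondition.plus (Literature.Probability.LatticeModels.spinAt (0, 0)))}) 0 Literature.Probability.LatticeModels.BoundaryCondition.plus (Literature.Probability.LatticeModels.spinMonomial fun i => (x i, 0)))) ρ S ∧ Literature.Probability.LatticeModels.IsNondegenerateTwoPoint S ∧ Literature.Probability.LatticeModels.IsMoebiusCovariant Δ S ∧ Literature.Probability.LatticeModels.HasNontrivialU4 S) → (∃ (ρ : ℝ → ℝ) (Δ : ℝ) (S : Literature.Probability.LatticeModels.CorrFamily 3), (∀ δ ∈ Set.Ioc (0:ℝ) 1, 0 < ρ δ) ∧ 0 < Δ ∧ Literature.Probability.LatticeModels.HasPointwiseScalingLimit (fun (n : ℕ) (x : Fin n → Literature.Probability.LatticeModels.Site 3) => limUnder Filter.atTop (fun L : ℕ => Literature.Probability.LatticeModels.isingExpect (Literature.Probability.LatticeModels.zdGraph 3 □ Literature.Probability.LatticeModels.torusGraph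 1 M) (Literature.Probability.LatticeModels.box 3 L ×ˢ Finset.univ) (sInf {β : ℝ | 0 ≤ β ∧ 0 < limUnder Filter.atTop (fun L : ℕ => Literature.Probability.LatticeModels.isingExpect (Literature.Probability.LatticeModels.zdGraph 3 □ Literature.Probability.LatticeModels.torusGraph 1 M) (Literature.Probability.LatticeModels.box 3 L ×ˢ Finset.univ) β 0 Literature.Probability.LatticeModels.BoundaryCondition.plus (Literature.Probability.LatticeModels.spinAt (0, 0)))}) 0 Literature.Probability.LatticeModels.BoundaryCondition.plus (Literature.Probability.LatticeModels.spinMonomial fun i => (x i, 0)))) ρ S ∧ Literature.Probability.LatticeModels.IsNondegenerateTwoPoint S ∧ Literature.Probability.LatticeModels.IsMoebiusCovariant Δ S ∧ Literature.Probability.LatticeModels.HasNontrivialU4 S)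

-- earlier LayerOneIsTarget (stmt-CriticalPhenomena-4816, replaced 2026-08-15T16:53:42Z -> stmt-CriticalPhenomena-11230): retired by None — (∃ (ρ : ℝ → ℝ) (Δ : ℝ) (S : Literature.Probability.LatticeModels.CorrFamily 3), (∀ δ ∈ Set.Ioc (0:ℝ) 1, 0 < ρ δ) ∧ 0 < Δ ∧ Literature.Probability.LatticeModels.HasPointwiseScalingLimit (fun (n : ℕ) (x : Fin n → Literature.Probability.LatticeModels.Site 3) => limU
/-- item stmt-CriticalPhenomena-11230 · support · rank 9 · open · by planner
sources: FriedliVelenik2017, Literature.Probability.LatticeModels.criticalCorr, Ising3DConformalLimit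
[support] [support, encoding check, provable now] The M = 1 member of the family IS the target: the
slab statement at M = 1 (graph zdGraph 3 □ torusGraph 1 1 = ℤ³ × one point, no ring edges; boxes box
3 L ×ˢ univ; plus boundary condition; β_c(1); layer-0 spin monomials) is equivalent to the conjunct
Ising3DConformalLimit (the sub-problem Statement decl by name; =
Literature.Probability.LatticeModels.CritIsing3DConformalLimit by rfl — restated 2026-08-15 to name
the @[summit_statement] abbrev so the Literature conjecture is target-side, not a cone dependency).
Proof: transport isingExpect along the graph isomorphism (x, ∗) ↦ x (IsingTransport /
IsingAutomorphismCovariance), so the slab plus state, magnetisation, β_c(1) and critical correlators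
are literally plusExpect 3, spontaneousMagnetization 3, criticalBeta 3, criticalCorr 3. Guards the
inlined encoding used by all cruxes and, from rev 2, is LOAD-BEARING: the deciding theorem ends with
it (P(1) → conjunct). [difficulty: provable-now] -/
@[route_item "route-CriticalPhenomena-FourToThreeSlab", crux]
def LayerOneIsTarget : Prop :=
  (∃ (ρ : ℝ → ℝ) (Δ : ℝ) (S : Literature.Probability.LatticeModels.CorrFamily 3), (∀ δ ∈ Set.Ioc (0:ℝ) 1, 0 < ρ δ) ∧ 0 < Δ ∧ Literature.Probability.LatticeModels.HasPointwiseScalingLimit (fun (n : ℕ) (x : Fin n → Literature.Probability.LatticeModels.Site 3) => limUnder Filter.atTop (fun L : ℕ => Literature.Probability.LatticeModels.isingExpect (Literature.Probability.LatticeModels.zdGraph 3 □ Literature.Probability.LatticeModels.torusGraph 1 1) (Literature.Probability.LatticeModels.box 3 L ×ˢ Finset.univ) (sInf {β : ℝ | 0 ≤ β ∧ 0 < limUnder Filter.atTop (fun L : ℕ => Literature.Probability.LatticeModels.isingExpect (Literature.Probability.LatticeModels.zdGraph 3 □ Literature.Probability.LatticeModels.torusGraph 1 1) (Literature.Probability.LatticeModels.box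 3 L ×ˢ Finset.univ) β 0 Literature.Probability.LatticeModels.BoundaryCondition.plus (Literature.Probability.LatticeModels.spinAt (0, 0)))}) 0 Literature.Probability.LatticeModels.BoundaryCondition.plus (Literature.Probability.LatticeModels.spinMonomial fun i => (x i, 0)))) ρ S ∧ Literature.Probability.LatticeModels.IsNondegenerateTwoPoint S ∧ Literature.Probability.LatticeModels.IsMoebiusCovariant Δ S ∧ Literature.Probability.LatticeModels.HasNontrivialU4 S) ↔ Ising3DConformalLimit

/-- item stmt-CriticalPhenomena-4817 · support · rank 9 · open · by planner
sources: FriedliVelenik2017, GriffithsSimon1973, FisherBarber1972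
[support] [support, well-posedness of the family] For every M ≥ 1 the slab critical point is a
genuine finite positive number below the 3D one: 0 < β_c(M) ≤ β_c(ℤ³) = criticalBeta 3. Upper bound:
GKS — adding the inter-layer bonds to M decoupled copies of ℤ³ raises ⟨σ_(0,0)⟩⁺ in every box, so
m*_M(β) ≥ m*_ℤ³(β) and the infimum drops (needs the ℤ³ set non-empty: β_c(3) < ∞, Peierls). Lower
bound: the slab graph has degree ≤ 8, so for 8 tanh β < 1 (high temperature, uniformly in M) the
plus state has zero magnetisation (Fisher/Griffiths high-temperature bound or Dobrushin uniqueness).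
Expected also (not filed): β_c(M) ↓ β_c(ℤ⁴) ≈ 0.1497 with shift ≍ M^(-2) up to logarithms
(FisherBarber1972, CapehartFisher1976). [difficulty: provable-now] -/
@[route_item "route-CriticalPhenomena-FourToThreeSlab", crux]
def SlabCriticalPointSandwich : Prop :=
  ∀ (M : ℕ) [NeZero M], 0 < sInf {β : ℝ | 0 ≤ β ∧ 0 < limUnder Filter.atTop (fun L : ℕ => Literature.Probability.LatticeModels.isingExpect (Literature.Probability.LatticeModels.zdGraph 3 □ Literature.Probability.LatticeModels.torusGraph 1 M) (Literature.Probability.LatticeModels.box 3 L ×ˢ Finset.univ) β 0 Literature.Probability.LatticeModels.BoundaryCondition.plus (Literature.Probability.LatticeModels.spinAt (0, 0)))} ∧ sInf {β : ℝ | 0 ≤ β ∧ 0 < limUnder Filter.atTop (fun L : ℕ => Literature.Probability.LatticeModels.isingExpect (Literature.Probability.LatticeModels.zdGraph 3 □ Literature.Probability.LatticeModels.torusGraph 1 M) (Literature.Probability.LatticeModels.box 3 L ×ˢ Finset.univ) β 0 Literature.Probability.LatticeModels.BoundaryCondition.plus (Literature.Probability.LatticeModels.spinAt (0, 0)))} ≤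 Literature.Probability.LatticeModels.criticalBeta 3

-- earlier Assembly (stmt-CriticalPhenomena-4818, replaced 2026-08-15T16:53:42Z -> stmt-CriticalPhenomena-11231): retired by None — Summit.CriticalPhenomena.Ising3DConformalLimit.Theses.FourToThreeSlab.SlabGaussianWindow → Summit.CriticalPhenomena.Ising3DConformalLimit.Theses.FourToThreeSlab.SlabInfraredCompletion → Summit.CriticalPhenomena.Ising3DConformalLimit.Theses.FourToThreeSlab.SlabUniversalit
/-- item stmt-CriticalPhenomena-11231 · assembly · rank 1 · open · by planner
sources: Aizenman2021CDM, AizenmanDuminilCopinAnnals2021, DuminilCopinICM2022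
[assembly] SlabGaussianWindow → SlabInfraredCompletion → RingFamilyUniversality → LayerOneIsTarget →
Ising3DConformalLimit (the conjunct; root abbrev of
Literature.Probability.LatticeModels.CritIsing3DConformalLimit, rfl). Rev-2 spine (route-repair g2
after route review c9f4b86e): pure logic — from P(M) eventually in M (S2) and P(M+1) → P(M) (S3)
descend to P(1), then LayerOneIsTarget; sorry-free in the planner's Sketch2.lean and identical in
content to the deciding theorem `closes`, which does not wait for this item. S1 is carried unused
(certified start / kill switch). -/
@[route_item "route-CriticalPhenomena-FourToThreeSlab", crux]
def Assembly : Prop :=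
  Summit.CriticalPhenomena.Ising3DConformalLimit.Theses.FourToThreeSlab.SlabGaussianWindow → Summit.CriticalPhenomena.Ising3DConformalLimit.Theses.FourToThreeSlab.SlabInfraredCompletion → Summit.CriticalPhenomena.Ising3DConformalLimit.Theses.FourToThreeSlab.RingFamilyUniversality → Summit.CriticalPhenomena.Ising3DConformalLimit.Theses.FourToThreeSlab.LayerOneIsTarget → Ising3DConformalLimit

-- records of items no longer active in this route (dropped / restated):
-- earlier SlabUniversality (stmt-CriticalPhenomena-4815, replaced 2026-08-15T16:53:42Z -> stmt-CriticalPhenomena-11229): retired by None — (∀ᶠ M : ℕ in Filter.atTop, ∀ [NeZero M], ∃ (ρ : ℝ → ℝ) (Δ : ℝ) (S : Literature.Probability.LatticeModels.CorrFamily 3), (∀ δ ∈ Set.Ioc (0:ℝ) 1, 0 < ρ δ) ∧ 0 < Δ ∧ Literature.Probability.LatticeModels.HasPointwiseScalingLimit (fun (n : ℕ) (x : Fin n → Literature.P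

/-! D-0027 §2.1 — DECIDING THEOREM (planner-authored via `route open/edit --closes-file`; by planner-rrepair-CriticalPhenomena-FourToThreeS-647d721a-g2-0 2026-08-15T16:53:42Z):
its hypotheses are this route's items and its conclusion the sub-problem Statement (glue_lint), and it elaborates with this file. -/

@[closes "route-CriticalPhenomena-FourToThreeSlab"] theorem closes :
    SlabInfraredCompletion → SlabGaussianWindow → RingFamilyUniversality → LayerOneIsTarget →
      SlabCriticalPointSandwich → Assembly → _root_.Ising3DConformalLimit := by
  intro hIR _hWindow hStep hOne _hSandwich _hAssembly
  -- pure logic: a property holding for all large ring sizes M and descending one ring size at a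
  -- time (M + 1 ⇒ M) holds for every M, in particular for M = 1, which LayerOneIsTarget
  -- identifies with the conjunct.
  have descent : ∀ (Q : ℕ → Prop), (∀ᶠ M in Filter.atTop, Q M) → (∀ M : ℕ, Q (M + 1) → Q M) →
      ∀ M : ℕ, Q M := by
    intro Q hQ hS M
    obtain ⟨M₀, hM₀⟩ := Filter.eventually_atTop.1 hQ
    have hk : ∀ k : ℕ, Q (M + k) → Q M := by
      intro k
      induction k with
      | zero => exact id
      | succ k ih => exact fun h => ih (hS (M + k) h)
    exact hk M₀ (hM₀ (M + M₀) (Nat.le_add_left M₀ M))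
  have hAll := descent (fun M : ℕ => ∀ [NeZero M], _) hIR (fun M hQ => by
    intro inst
    haveI : NeZero (M + 1) := ⟨Nat.succ_ne_zero M⟩
    exact hStep M hQ)
  exact hOne.mp (hAll 1)

end Summit.CriticalPhenomena.Ising3DConformalLimit.Theses.FourToThreeSlab
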